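import Summits.HodgeConjecture.HodgeConjecture.Theses.HeckePrymWeil
import Summits.HodgeConjecture.HodgeConjecture.Theorems.WeilTwelvefoldsSqrtMinus7.Negative.EigenvalueTyping
import Summits.HodgeConjecture.HodgeConjecture.Theorems.HeckePrymWeilWeilTwelvefoldsSqrtMinus7WeilMultiplicity
import Summits.HodgeConjecture.HodgeConjecture.Theorems.HeckePrymWeilHeckePrymAnchorsSurfaceProductStep
import Literature.AlgebraicGeometry.Motives.AbelianVarietyProduct
import Literature.AlgebraicGeometry.Motives.AbelianVarietyProductDimProofs
import Literature.AlgebraicGeometry.Motives.AbelianVarietyCohomologyExteriorH1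
import Literature.AlgebraicGeometry.HodgeTheory.WeilClassesCyclicPrymTyping
import Literature.AlgebraicGeometry.HodgeTheory.WeilClassesIsogenyDescent
import Literature.AlgebraicGeometry.HodgeTheory.WeilClassesFourfoldsProofs
import HarnessLib

/-!
# Crux `WeilTwelvefoldsSqrtMinus7` (stmt-HodgeConjecture-1261), line `isotypic-unimodular-saturation` — stub `stub_productAnchor` (CLOSED, unconditional)

**The product anchor is algebraic and isogeny-stable.** Let `(X, φ_X)` be a complex abelian
12-fold and `(B', φ_{B'})` a complex abelian surface, both with `φ ≫ φ = -7` and with typed Weil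
planes `Eig((𝟙+φ)^*, (1+i√7)^{2n}) ⊔ Eig((𝟙+φ)^*, (1-i√7)^{2n})` (`n = 6`, resp. `n = 1`)
consisting of algebraic classes; let `(Y, ψ)` be a complex abelian 14-fold with `ψ ≫ ψ = -7` and an
isogeny pair `f : Y → X × B'` (flat), `g : X × B' → Y`, `f ≫ g = m·𝟙_Y` (`m ≥ 1`),
`g ≫ ψ = (φ_X × φ_{B'}) ≫ g`. Then every class of the typed Weil plane of `(Y, ψ)` in
`H¹⁴(Y(ℂ); ℂ)` is algebraic. VERBATIM the registered stub `stub_productAnchor` of the skeleton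
`Cruxes/WeilTwelvefoldsSqrtMinus7/Lines/isotypic_unimodular_saturation.lean` (it is `h₃` of
`WeilTwelvefoldsSqrtMinus7_of`).

## Proof (van Geemen LNM 1594, 3.6–3.7 and proof of Thm. 6.12; Schoen 1998 §10; Markman §11.5 Step 1)

1. *Typing bridge* (`eigenspace_one_add_eq_weilClassesPlus/Minus`): for `φ ≫ φ = -7` on any complex
   abelian variety, `Eig((𝟙+φ)^*|H^{2n}, (1 ± i√7)^{2n}) = weilClassesPlus/Minus A φ n 7`, the tree's
   joint eigen-lines of ALL test pull-backs `(x·𝟙 + y·φ)^*` (`HodgeTheory/WeilClasses`) — the tree's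
   single-operator typing theorem `eigenspace_map_nsmul_id_add_nsmul_eq_pullbackEigenclasses` fed with
   the PROVED `H•(A(ℂ); ℂ) = ⋀• H¹` (`Motives.abelianVarietyCohomologyExteriorH1_holds`) and the landed
   separation `separation_one_add_sqrt_minus_seven` (`(1+μ)ᵃ(1-μ)ᵇ ≠ (1+μ)^{2n}` for `b ≥ 1`,
   `μ = ± i√7`; `Negative.EigenvalueTyping.mixed_eq_plus_iff/minus_iff`). So all three typed planes
   (of `X`, `B'`, `Y`) are the planes `weilClassesOf _ _ n 7`.
2. *Product step* (the landed `HeckePrymWeilLine.stub_surfaceProductStep_of_exteriorH1`, now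
   unconditional since its hypothesis `abelianVarietyCohomologyExteriorH1` is proved): the Weil plane
   of `(X × B', φ_X × φ_{B'})` in degree `14` consists of algebraic classes — each of its two lines is
   spanned by the exterior product `pr_X^* w_± ∪ pr_{B'}^* b_±` of non-zero generators of the lines of
   `X` and `B'` (Künneth non-vanishing), which is algebraic (Voisin II Prop. 9.20, exterior products).
3. *Isogeny transport* (pattern `WeilClassesIsogenyDescent.mem_algebraicClasses_of_isogeny_of_mem_weilClassesOf`,
   minus its rationality/Hodge-type bookkeeping): `g^* c` lies in the Weil plane of `X × B'`
   (`map_mem_weilClassesOf_of_comm`), hence is algebraic; `f^* g^* c = (m·𝟙_Y)^* c = m¹⁴ · c`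
   (`map_nsmul_id_eq_of_mem_weilClassesOf`) is algebraic by flat pull-back
   (`map_mem_algebraicClasses_of_flat`), and `m¹⁴ ≠ 0`.

The hypothesis `Y.dim = 14` of the registered signature is not used.
-/

noncomputable section

-- single-problem summit (Problem = Summit): the mandated namespace repeats `HodgeConjecture`.
set_option linter.dupNamespace false

open CategoryTheory
open Literature.AlgebraicGeometry Literature.AlgebraicGeometry.Motives
  Literature.AlgebraicGeometry.HodgeTheory Literature.AlgebraicTopology.SingularHomology

namespace Summit.HodgeConjecture.HodgeConjecture.Theorems.WeilTwelvefoldsSqrtMinus7.IsotypicUnimodularSaturation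

open Summit.HodgeConjecture.HodgeConjecture.Theorems.WeilTwelvefoldsSqrtMinus7.AmnesicSecantSheaves
  (separation_one_add_sqrt_minus_seven)
open Summit.HodgeConjecture.HodgeConjecture.Theorems.HeckePrymWeilLine
  (stub_surfaceProductStep_of_exteriorH1)

/-! ### The typing bridge `Eig((𝟙+φ)^*, (1 ± i√7)^{2n}) = E_±` -/

/-- **`Eig((𝟙 + φ)^*|H^{2n}, (1 + i√7)^{2n}) = E₊ = weilClassesPlus A φ n 7`** for every endomorphism
`φ` of a complex abelian variety `A` with `φ ≫ φ = -7` (no dimension hypothesis): the route's literal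
`+`-eigenspace IS the tree's `+`-Weil line `⋀^{2n} V₊` (van Geemen, proof of Thm. 6.12: in the wedge
eigenbasis of `H^{2n} = ⋀^{2n} H¹`, `(𝟙+φ)^*` acts on `⋀ᵃV₊ ⊗ ⋀ᵇV₋` by `(1+i√7)ᵃ(1-i√7)ᵇ`, which is
`(1+i√7)^{2n}` only for `b = 0`; the tree's `eigenspace_map_nsmul_id_add_nsmul_eq_pullbackEigenclasses`
with `abelianVarietyCohomologyExteriorH1_holds` and `separation_one_add_sqrt_minus_seven`).
[cite: vanGeemen1994HodgeAV, proof of Thm. 6.12] -/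
theorem eigenspace_one_add_eq_weilClassesPlus (A : AbelianVariety ℂ) {φ : A ⟶ A}
    (hφ : φ ≫ φ = -(7 • 𝟙 A)) (n : ℕ) :
    Module.End.eigenspace (complexBetti.map (𝟙 A + φ).hom.hom.hom (2 * n)).hom
        ((1 + Complex.I * (Real.sqrt (7 : ℝ) : ℂ)) ^ (2 * n)) = weilClassesPlus A φ n 7 := by
  have h := eigenspace_map_nsmul_id_add_nsmul_eq_pullbackEigenclasses
    (abelianVarietyCohomologyExteriorH1_holds.hasExteriorCohomologyH1 A) (n := n) (d := 7)
    (by norm_num) hφ (μ := Complex.I * (Real.sqrt (7 : ℝ) : ℂ)) (Or.inl rfl) 1 1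
    (separation_one_add_sqrt_minus_seven n _ (Or.inl rfl))
  have hop : (𝟙 A + φ : A ⟶ A) = (1 : ℕ) • 𝟙 A + (1 : ℕ) • φ := by rw [one_smul, one_smul]
  have hval : (1 + Complex.I * (Real.sqrt (7 : ℝ) : ℂ)) ^ (2 * n) =
      (((1 : ℕ) : ℂ) + ((1 : ℕ) : ℂ) * (Complex.I * (Real.sqrt (7 : ℝ) : ℂ))) ^ (2 * n) := by
    rw [Nat.cast_one, one_mul]
  have e : (fun x y : ℕ => ((x : ℂ) + (y : ℂ) * Complex.I * (Real.sqrt ((7 : ℕ) : ℝ) : ℂ)) ^ (2 * n)) =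
      fun x y : ℕ => ((x : ℂ) + (y : ℂ) * (Complex.I * (Real.sqrt ((7 : ℕ) : ℝ) : ℂ))) ^ (2 * n) := by
    funext x y; rw [mul_assoc]
  rw [hop, hval]
  -- `√(7 : ℝ)` versus `√((7 : ℕ) : ℝ)`: definitionally equal numerals
  exact h.trans (by rw [weilClassesPlus, e]; rfl)

/-- **`Eig((𝟙 + φ)^*|H^{2n}, (1 - i√7)^{2n}) = E₋ = weilClassesMinus A φ n 7`** (`= ⋀^{2n} V₋`), for
`φ ≫ φ = -7` on any complex abelian variety (separation `mixed_eq_minus_iff`).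
[cite: vanGeemen1994HodgeAV, proof of Thm. 6.12] -/
theorem eigenspace_one_add_eq_weilClassesMinus (A : AbelianVariety ℂ) {φ : A ⟶ A}
    (hφ : φ ≫ φ = -(7 • 𝟙 A)) (n : ℕ) :
    Module.End.eigenspace (complexBetti.map (𝟙 A + φ).hom.hom.hom (2 * n)).hom
        ((1 - Complex.I * (Real.sqrt (7 : ℝ) : ℂ)) ^ (2 * n)) = weilClassesMinus A φ n 7 := by
  have h := eigenspace_map_nsmul_id_add_nsmul_eq_pullbackEigenclasses
    (abelianVarietyCohomologyExteriorH1_holds.hasExteriorCohomologyH1 A) (n := n) (d := 7)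
    (by norm_num) hφ (μ := -(Complex.I * (Real.sqrt (7 : ℝ) : ℂ))) (Or.inr rfl) 1 1
    (separation_one_add_sqrt_minus_seven n _ (Or.inr rfl))
  have hop : (𝟙 A + φ : A ⟶ A) = (1 : ℕ) • 𝟙 A + (1 : ℕ) • φ := by rw [one_smul, one_smul]
  have hval : (1 - Complex.I * (Real.sqrt (7 : ℝ) : ℂ)) ^ (2 * n) =
      (((1 : ℕ) : ℂ) + ((1 : ℕ) : ℂ) * (-(Complex.I * (Real.sqrt (7 : ℝ) : ℂ)))) ^ (2 * n) := by
    rw [Nat.cast_one, one_mul, ← sub_eq_add_neg]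
  have e : (fun x y : ℕ => ((x : ℂ) - (y : ℂ) * Complex.I * (Real.sqrt ((7 : ℕ) : ℝ) : ℂ)) ^ (2 * n)) =
      fun x y : ℕ => ((x : ℂ) + (y : ℂ) * (-(Complex.I * (Real.sqrt ((7 : ℕ) : ℝ) : ℂ)))) ^ (2 * n) := by
    funext x y; rw [mul_neg, ← sub_eq_add_neg, mul_assoc]
  rw [hop, hval]
  exact h.trans (by rw [weilClassesMinus, e]; rfl)

/-- **The route's typed Weil plane is the tree's Weil plane**:
`Eig((𝟙+φ)^*, (1+i√7)^{2n}) ⊔ Eig((𝟙+φ)^*, (1-i√7)^{2n}) = weilClassesOf A φ n 7 = E₊ ⊔ E₋` for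
`φ ≫ φ = -7` ("`⋀^{2n} W` and `⋀^{2n} W^*` … span `(⋀^{2n}_K H¹(X, ℚ)) ⊗_ℚ ℂ`").
[cite: vanGeemen1994HodgeAV, 4.9 and proof of Thm. 6.12] -/
theorem eigenspace_sup_eigenspace_eq_weilClassesOf (A : AbelianVariety ℂ) {φ : A ⟶ A}
    (hφ : φ ≫ φ = -(7 • 𝟙 A)) (n : ℕ) :
    Module.End.eigenspace (complexBetti.map (𝟙 A + φ).hom.hom.hom (2 * n)).hom
        ((1 + Complex.I * (Real.sqrt (7 : ℝ) : ℂ)) ^ (2 * n)) ⊔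
      Module.End.eigenspace (complexBetti.map (𝟙 A + φ).hom.hom.hom (2 * n)).hom
        ((1 - Complex.I * (Real.sqrt (7 : ℝ) : ℂ)) ^ (2 * n)) = weilClassesOf A φ n 7 := by
  rw [weilClassesOf, eigenspace_one_add_eq_weilClassesPlus A hφ n,
    eigenspace_one_add_eq_weilClassesMinus A hφ n]

/-- **Algebraicity of the typed Weil plane, retyped**: if every class of
`Eig((𝟙+φ)^*, (1+i√7)^{2n}) ⊔ Eig((𝟙+φ)^*, (1-i√7)^{2n})` is algebraic (the route's hypothesis shape),
then `weilClassesOf A φ n 7 ≤ algebraicClasses A.X n` (the shape of the tree's Weil-class API).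
[cite: vanGeemen1994HodgeAV, 4.9 and proof of Thm. 6.12] -/
theorem weilClassesOf_le_algebraicClasses_of_eigenspaces (A : AbelianVariety ℂ) {φ : A ⟶ A}
    (hφ : φ ≫ φ = -(7 • 𝟙 A)) (n : ℕ)
    (halg : ∀ c : complexBetti A.X (2 * n),
      c ∈ Module.End.eigenspace (complexBetti.map (𝟙 A + φ).hom.hom.hom (2 * n)).hom
            ((1 + Complex.I * (Real.sqrt (7 : ℝ) : ℂ)) ^ (2 * n)) ⊔
          Module.End.eigenspace (complexBetti.map (𝟙 A + φ).hom.hom.hom (2 * n)).hom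
            ((1 - Complex.I * (Real.sqrt (7 : ℝ) : ℂ)) ^ (2 * n)) →
        c ∈ algebraicClasses A.X n) :
    weilClassesOf A φ n 7 ≤ algebraicClasses A.X n := by
  intro c hc
  rw [← eigenspace_sup_eigenspace_eq_weilClassesOf A hφ n] at hc
  exact halg c hc

/-! ### The stub -/

/-- **Stub 3 `stub_productAnchor`, CLOSED — the product anchor is algebraic and isogeny-stable.**
Let `(X, φ_X)` be a complex abelian 12-fold with `φ_X ≫ φ_X = -7` whose typed Weil plane (BOTH
eigenspaces of `(𝟙+φ_X)^*` on `H¹²`, eigenvalues `(1±i√7)¹²`) consists of algebraic classes, and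
`(B', φ_{B'})` a complex abelian SURFACE with `φ_{B'} ≫ φ_{B'} = -7` whose typed Weil plane in `H²`
consists of algebraic classes. Let `(Y, ψ)` be a complex abelian 14-fold with `ψ ≫ ψ = -7` and an
isogeny pair towards `X × B'`: `f : Y → X × B'` flat, `g : X × B' → Y` with
`g ≫ ψ = (φ_X × φ_{B'}) ≫ g` and `f ≫ g = m·𝟙_Y`, `m ≥ 1`. Then every class of the typed Weil plane
of `(Y, ψ)` in `H¹⁴(Y(ℂ); ℂ)` is algebraic. PROOF: (1) all typed planes are the tree's
`weilClassesOf _ _ n 7` (`eigenspace_sup_eigenspace_eq_weilClassesOf`: `H• = ⋀•H¹` and the eigenvalue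
separation `mixed_eq_plus_iff/minus_iff`); (2) the Weil plane of `(X × B', φ_X × φ_{B'})` is
algebraic — Schoen's basis statement "`W_{A×A'} ⊗ ℂ : {ω_{1,σᵢ} ∧ ⋯ ∧ ω_{6,σᵢ}}`": each line
`E_±(X × B')` is spanned by the non-zero (Künneth) algebraic (exterior product of algebraic classes,
Voisin II Prop. 9.20) class `pr_X^* w_± ∪ pr_{B'}^* b_±` (the landed
`HeckePrymWeilLine.stub_surfaceProductStep_of_exteriorH1`, unconditional by
`abelianVarietyCohomologyExteriorH1_holds`); (3) van Geemen 3.6–3.7 / Markman §11.5 Step 1: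
`g^* c ∈ W_{X×B'} ⊗ ℂ` (`map_mem_weilClassesOf_of_comm`) is algebraic, so is its flat pull-back
`f^* g^* c = (m·𝟙_Y)^* c = m¹⁴ · c` (`map_mem_algebraicClasses_of_flat`,
`map_nsmul_id_eq_of_mem_weilClassesOf`), and `m¹⁴ ≠ 0`. The hypothesis `Y.dim = 14` is not used.
[cite: vanGeemen1994HodgeAV, 3.6–3.7 and proof of Thm. 6.12]
[cite: Schoen1998HodgeWeilAddendum, §10 (proof of the Proposition, bases of W ⊗ ℂ)]
[cite: Markman2025SurveySecant, §11.5 Step 1] [cite: VoisinHodgeII2003, proof of Prop. 9.20 (first display)] -/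
theorem stub_productAnchor :
    ∀ (X : AbelianVariety ℂ) (φX : X ⟶ X), X.dim = 12 → φX ≫ φX = -((7 : ℤ) • 𝟙 X) →
      (∀ c : complexBetti X.X 12,
        c ∈ Module.End.eigenspace (complexBetti.map (𝟙 X + φX).hom.hom.hom 12).hom
              ((1 + Complex.I * (Real.sqrt (7 : ℝ) : ℂ)) ^ 12) ⊔
            Module.End.eigenspace (complexBetti.map (𝟙 X + φX).hom.hom.hom 12).hom
              ((1 - Complex.I * (Real.sqrt (7 : ℝ) : ℂ)) ^ 12) →
        c ∈ algebraicClasses X.X 6) →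
    ∀ (B' : AbelianVariety ℂ) (φB' : B' ⟶ B'), B'.dim = 2 → φB' ≫ φB' = -((7 : ℤ) • 𝟙 B') →
      (∀ b : complexBetti B'.X 2,
        b ∈ Module.End.eigenspace (complexBetti.map (𝟙 B' + φB').hom.hom.hom 2).hom
              ((1 + Complex.I * (Real.sqrt (7 : ℝ) : ℂ)) ^ 2) ⊔
            Module.End.eigenspace (complexBetti.map (𝟙 B' + φB').hom.hom.hom 2).hom
              ((1 - Complex.I * (Real.sqrt (7 : ℝ) : ℂ)) ^ 2) →
        b ∈ algebraicClasses B'.X 1) →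
    ∀ (Y : AbelianVariety ℂ) (ψ : Y ⟶ Y), Y.dim = 14 → ψ ≫ ψ = -((7 : ℤ) • 𝟙 Y) →
    ∀ (f : Y ⟶ X.prod B') (g : X.prod B' ⟶ Y) (m : ℕ),
      AlgebraicGeometry.Flat f.hom.hom.hom.left → 0 < m → f ≫ g = m • 𝟙 Y →
      g ≫ ψ = AbelianVariety.prodLift (AbelianVariety.fst X B' ≫ φX) (AbelianVariety.snd X B' ≫ φB') ≫ g →
    ∀ c : complexBetti Y.X 14,
      c ∈ Module.End.eigenspace (complexBetti.map (𝟙 Y + ψ).hom.hom.hom 14).hom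
            ((1 + Complex.I * (Real.sqrt (7 : ℝ) : ℂ)) ^ 14) ⊔
          Module.End.eigenspace (complexBetti.map (𝟙 Y + ψ).hom.hom.hom 14).hom
            ((1 - Complex.I * (Real.sqrt (7 : ℝ) : ℂ)) ^ 14) →
      c ∈ algebraicClasses Y.X 7 := by
  intro X φX hX hφX hXalg B' φB' hB' hφB' hB'alg Y ψ _hY hψ f g m hflat hm hfg hgψ c hc
  have hφX' : φX ≫ φX = -((7 : ℕ) • 𝟙 X) := by rw [hφX, ← natCast_zsmul]; rfl
  have hφB'' : φB' ≫ φB' = -((7 : ℕ) • 𝟙 B') := by rw [hφB', ← natCast_zsmul]; rfl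
  have hψ' : ψ ≫ ψ = -((7 : ℕ) • 𝟙 Y) := by rw [hψ, ← natCast_zsmul]; rfl
  -- (1) the typed Weil planes of `X`, `B'` are the tree's Weil planes, and they are algebraic
  have hXW : weilClassesOf X φX 6 7 ≤ algebraicClasses X.X 6 :=
    weilClassesOf_le_algebraicClasses_of_eigenspaces X hφX' 6 hXalg
  have hB'W : weilClassesOf B' φB' 1 7 ≤ algebraicClasses B'.X 1 :=
    weilClassesOf_le_algebraicClasses_of_eigenspaces B' hφB'' 1 hB'alg
  -- (2) the product step: the Weil plane of `(X × B', φ_X × φ_{B'})` in degree `14` is algebraic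
  have hprod : weilClassesOf (X.prod B')
      (AbelianVariety.prodLift (AbelianVariety.fst X B' ≫ φX) (AbelianVariety.snd X B' ≫ φB')) 7 7 ≤
        algebraicClasses (X.prod B').X 7 :=
    stub_surfaceProductStep_of_exteriorH1 abelianVarietyCohomologyExteriorH1_holds 7 (by norm_num)
      (by norm_num) le_rfl 6 X φX B' φB' hX hB' hφX hφB' hXW hB'W
  -- (3) isogeny transport: `c` is a Weil class of `(Y, ψ)` in the tree's typing …
  have hcW : c ∈ weilClassesOf Y ψ 7 7 := by
    rw [← eigenspace_sup_eigenspace_eq_weilClassesOf Y hψ' 7]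
    exact hc
  -- … `g^* c` lies in the Weil plane of `X × B'`, hence is algebraic …
  have hgc : singularCohomology.map ℂ ℂ (AlgPoints.mapContinuous (L := ℂ) g.hom.hom.hom) (2 * 7) c ∈
      algebraicClasses (X.prod B').X 7 :=
    hprod (map_mem_weilClassesOf_of_comm (n := 7) (d := 7) hgψ hcW)
  -- … and so is its flat pull-back `f^* g^* c = (m • 𝟙 Y)^* c = m¹⁴ • c`
  haveI : AlgebraicGeometry.IsLocallyNoetherian Y.X.left :=
    IsSmoothProjective.isLocallyNoetherian_holds (AbelianVariety.isSmoothProjective_holds (A := Y))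
  haveI : AlgebraicGeometry.IsLocallyNoetherian (X.prod B').X.left :=
    IsSmoothProjective.isLocallyNoetherian_holds
      (AbelianVariety.isSmoothProjective_holds (A := X.prod B'))
  haveI : AlgebraicGeometry.Flat f.hom.hom.hom.left := hflat
  have hfgc := map_mem_algebraicClasses_of_flat f.hom.hom.hom hgc
  have key : complexBetti.map f.hom.hom.hom (2 * 7)
      (singularCohomology.map ℂ ℂ (AlgPoints.mapContinuous (L := ℂ) g.hom.hom.hom) (2 * 7) c) =
        ((m : ℂ) ^ (2 * 7)) • c := by
    change singularCohomology.map ℂ ℂ (AlgPoints.mapContinuous (L := ℂ) f.hom.hom.hom) (2 * 7)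
      (singularCohomology.map ℂ ℂ (AlgPoints.mapContinuous (L := ℂ) g.hom.hom.hom) (2 * 7) c) = _
    rw [abelianVarietyHom_map_map_apply, hfg, map_nsmul_id_eq_of_mem_weilClassesOf m hcW]
  rw [key] at hfgc
  have hmC : ((m : ℂ) ^ (2 * 7)) ≠ 0 := pow_ne_zero _ (Nat.cast_ne_zero.mpr hm.ne')
  have h := Submodule.smul_mem (algebraicClasses Y.X 7) (((m : ℂ) ^ (2 * 7))⁻¹) hfgc
  rwa [smul_smul, inv_mul_cancel₀ hmC, one_smul] at h

end Summit.HodgeConjecture.HodgeConjecture.Theorems.WeilTwelvefoldsSqrtMinus7.IsotypicUnimodularSaturation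

end
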